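import Summits.CriticalPhenomena.PercolationContinuityZ3.Theorems.PercNearOneGluingNoHeavyConstsSingleEdgeValue
import Summits.CriticalPhenomena.PercolationContinuityZ3.Theorems.PercNearOneGluingNoHeavyConstsSingleEdgeReduction
import Literature.Probability.Percolation.TwoSetConditionalAssociation
import Literature.Probability.Percolation.KozmaNitzanSeparatingTriple
import HarnessLib

/-!
# The chain rule for `(G − xu; x, u, v, o, Y)` gives single-edge extremality of `G` at the pair functional `1{s(x,u) ∈ 𝐂_x}`
# (PAPER-2 track (ii): constants of the CSH family)

builds on p205010 (kernel theorem, internal audit signed; external expert review pending).  Support file (`--supports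
stmt-CriticalPhenomena-4575`), seat `prim-consts-2` (gen 3); rows A6/A11 of `run/shared/lean/prim/consts/CONSTANTS.md`; memo
`run/shared/lean/prim/consts/FROM-prim-consts-2-g3-CHAIN-RULE.md` §1(C)(iv).  No definitions, no sorries; standard axioms.

Notation: `μ = prodBernoulli w`, `μ₀` the law with the pair `e = s(x,u)` switched off; for a source set `S`, `R_S = {S ↮ Y}`; targets
`o` (observer) and `v`; `R₁ = R_{x}`, `R₂ = R_{xu}`, `R₃ = R_{xuv}`, `R_{xv}`; `A_i = R_i ∩ {o ∈ C_{S_i}}`, `N_i = R_i ∩ {v ∉ C_{S_i}}`.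

* `Consts.real_reach_avoid_insert_ge` — **source monotonicity** (any weights): for a source set `S`, a vertex `u`, a target `t` and an
  avoided set `Y`, `μ(R_{S∪u} ∩ {t ∈ C_{S∪u}}) · μ(R_S) ≥ μ(R_S ∩ {t ∈ C_S}) · μ(R_{S∪u})`, i.e. `P(t ∈ C_S | S ↮ Y)` does not decrease
  when a vertex is added to the source.  Proof: van den Berg–Häggström–Kahn's Theorem 1.4 with vertex sets (`C_S` versus `C_Y` given
  `S ↮ Y`): `{t ∈ C_S}` and `{u ∈ C_Y}` are negatively correlated, and `R_{S∪u} = R_S ∩ {u ∉ C_Y}`.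
* `Consts.see_pairOpen_of_chainRule` — **THEOREM.**  Let `x ≠ u`, `x, u, v ∉ Y`, all weights `< 1`.  If the single-edge chain rule
  (`Consts.SingleEdgeChainRule`'s inequality) holds for the data `(μ₀; x, u, v, o, Y)` — `μ₀(N₁)(μ₀(A₃)μ₀(R₂) − μ₀(A₂)μ₀(R₃)) ≤
  μ₀(N₂)(μ₀(A₃)μ₀(R₁) − μ₀(A₁)μ₀(R₃))` — then the level-0 single-edge-extremality margin of `G` (the inequality of `Consts.SingleEdgeExtremal`)
  is nonnegative at the functional `f = 1{s(x,u) ∈ 𝐂_x}`, for EVERY weight of the pair `s(x,u)`.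
  Proof: `Consts.covD_pairOpen_eq` puts both covariances in closed form (`μ₀`-quantities times `q(1−q)`, `q = w_e`); pinning `e` in the four
  `μ`-quantities of the margin (`Consts.real_split_pair`) and the polynomial identity
  `X_o·M − X_v·R = μ(D)·[(N₁A₂ − N₂A₁)·μ(D₁) − (N₁d₂ − N₂d₁)·μ(D₁ ∩ O)]` (`μ(D₁) = q d₃ + (1−q) d_{xv}`, `μ(D₁∩O) = q a₃ + (1−q) a_{xv}`)
  reduce the claim to the chain rule (the `q`-part) plus source monotonicity `a_{xv} d₃ ≤ a₃ d_{xv}`, `N₁ d₂ ≥ N₂ d₁` (the `(1−q)`-part).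
  So `Consts.SingleEdgeChainRule` implies SEE for every single-pair functional at the owner (the case `u = v` being the identity
  `Consts.covD_pairOpen_cross_eq`), and conversely SEE at `1{s(x,u) ∈ 𝐂_x}` for all weights of the pair forces the chain rule (memo §1(C)).
[cite: VandenbergHaggstromKahn2005, Thm. 1.4 (p. 7) with Remark 1 after Thm. 1.2 (p. 5); Thm. 1.1 (pp. 3–5)]
-/

noncomputable section

namespace Summit.CriticalPhenomena.PercolationContinuityZ3.Theorems

open MeasureTheory Set Literature.Probability.LatticeModels Literature.Probability.Percolation
open scoped Classical

namespace Consts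

variable {V : Type*} [Fintype V]

/-- **Source monotonicity of avoided-set connection probabilities.**  For a source set `S`, a vertex `u`, a target `t` and an avoided
set `Y`: `μ(R_S ∩ {∃ s ∈ S, s ↔ t}) · μ(R_{S ∪ {u}}) ≤ μ(R_{S∪{u}} ∩ {∃ s ∈ S ∪ {u}, s ↔ t}) · μ(R_S)` (`R_S = {S ↮ Y}`), i.e.
`P(t ∈ C_S | S ↮ Y) ≤ P(t ∈ C_{S∪u} | S∪u ↮ Y)`.  From vdBHK's Theorem 1.4 with vertex sets: given `S ↮ Y`, `1{t ∈ C_S}` and `1{u ∈ C_Y}`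
are negatively correlated, and `R_{S∪u} = R_S ∩ {u ↮ Y}`. [cite: VandenbergHaggstromKahn2005, Thm. 1.4 (p. 7) with Remark 1 after Thm. 1.2 (p. 5)] -/
theorem real_reach_avoid_insert_ge (w : Sym2 V → unitInterval) (S Y : Set V) (u t : V) :
    (prodBernoulli w).real ({ω : BondConfig V | ∀ s ∈ S, ∀ y ∈ Y, ¬ (openGraph ω).Reachable s y} ∩
        {ω | ∃ s ∈ S, (openGraph ω).Reachable s t}) *
      (prodBernoulli w).real {ω : BondConfig V | ∀ s ∈ insert u S, ∀ y ∈ Y, ¬ (openGraph ω).Reachable s y} ≤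
    (prodBernoulli w).real ({ω : BondConfig V | ∀ s ∈ insert u S, ∀ y ∈ Y, ¬ (openGraph ω).Reachable s y} ∩
        {ω | ∃ s ∈ insert u S, (openGraph ω).Reachable s t}) *
      (prodBernoulli w).real {ω : BondConfig V | ∀ s ∈ S, ∀ y ∈ Y, ¬ (openGraph ω).Reachable s y} := by
  classical
  set μ := prodBernoulli w with hμ
  have hmeas : ∀ T : Set (BondConfig V), MeasurableSet T := fun _ => MeasurableSet.of_discrete
  set D : Set (BondConfig V) := {ω | ∀ s ∈ S, ∀ y ∈ Y, ¬ (openGraph ω).Reachable s y} with hD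
  set D' : Set (BondConfig V) := {ω | ∀ s ∈ insert u S, ∀ y ∈ Y, ¬ (openGraph ω).Reachable s y} with hD'
  set T : Set (BondConfig V) := {ω | ∃ s ∈ S, (openGraph ω).Reachable s t} with hT
  set T' : Set (BondConfig V) := {ω | ∃ s ∈ insert u S, (openGraph ω).Reachable s t} with hT'
  set J : Set (BondConfig V) := {ω | ∃ y ∈ Y, (openGraph ω).Reachable y u} with hJ
  -- `D' = D ∩ Jᶜ` and `T ⊆ T'`
  have hD'eq : D' = D ∩ Jᶜ := by
    ext ω
    simp only [hD', hD, hJ, mem_setOf_eq, mem_inter_iff, mem_compl_iff, mem_insert_iff, forall_eq_or_imp, not_exists, not_and]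
    constructor
    · rintro ⟨hu, hS⟩
      exact ⟨hS, fun y hy hyu => hu y hy hyu.symm⟩
    · rintro ⟨hS, hu⟩
      exact ⟨fun y hy huy => hu y hy huy.symm, hS⟩
  have hTT' : D' ∩ T ⊆ D' ∩ T' := by
    rintro ω ⟨hω, s, hs, hr⟩
    exact ⟨hω, s, mem_insert_of_mem u hs, hr⟩
  -- vdBHK Thm 1.4 with the vertex sets `S` and `Y`
  set F : Set (Sym2 V) → ℝ := fun C => if (∃ s ∈ S, (openGraph C).Reachable s t) then (1 : ℝ) else 0 with hF
  set G : Set (Sym2 V) → ℝ := fun C => if (∃ y ∈ Y, (openGraph C).Reachable y u) then (1 : ℝ) else 0 with hG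
  have hFm : Monotone F := by
    refine TripodExchange.predIndicator_monotone ?_
    rintro C C' hCC' ⟨s, hs, hr⟩
    exact ⟨s, hs, hr.mono (openGraph_mono hCC')⟩
  have hGm : Monotone G := by
    refine TripodExchange.predIndicator_monotone ?_
    rintro C C' hCC' ⟨y, hy, hr⟩
    exact ⟨y, hy, hr.mono (openGraph_mono hCC')⟩
  have hFω : ∀ ω : BondConfig V, F (⋃ s ∈ S, openEdgeCluster ω s) = T.indicator 1 ω := by
    intro ω
    have hiff : (∃ s ∈ S, (openGraph (⋃ s' ∈ S, openEdgeCluster ω s')).Reachable s t) ↔ ∃ s ∈ S, (openGraph ω).Reachable s t := by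
      constructor
      · rintro ⟨s, hs, hr⟩; exact ⟨s, hs, (KNSep.reachable_iff_cluster ω S hs t).2 hr⟩
      · rintro ⟨s, hs, hr⟩; exact ⟨s, hs, (KNSep.reachable_iff_cluster ω S hs t).1 hr⟩
    simp only [hF, hiff]
    exact TwoSetConditionalAssociation.predIndicator_eq_indicator (fun ω' => ∃ s ∈ S, (openGraph ω').Reachable s t) ω
  have hGω : ∀ ω : BondConfig V, G (⋃ y ∈ Y, openEdgeCluster ω y) = J.indicator 1 ω := by
    intro ω
    have hiff : (∃ y ∈ Y, (openGraph (⋃ y' ∈ Y, openEdgeCluster ω y')).Reachable y u) ↔ ∃ y ∈ Y, (openGraph ω).Reachable y u := by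
      constructor
      · rintro ⟨y, hy, hr⟩; exact ⟨y, hy, (KNSep.reachable_iff_cluster ω Y hy u).2 hr⟩
      · rintro ⟨y, hy, hr⟩; exact ⟨y, hy, (KNSep.reachable_iff_cluster ω Y hy u).1 hr⟩
    simp only [hG, hiff]
    exact TwoSetConditionalAssociation.predIndicator_eq_indicator (fun ω' => ∃ y ∈ Y, (openGraph ω').Reachable y u) ω
  have key := BHK2006_twoSetConditionalAssociation.negCorrelation w S Y F G hFm hGm
  simp only [hFω, hGω, TripodExchange.setIntegral_indicator_one_eq, TripodExchange.setIntegral_indicator_mul_indicator_eq] at key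
  -- key : μ.real D * μ.real (D ∩ (T ∩ J)) ≤ μ.real (D ∩ T) * μ.real (D ∩ J)
  -- bookkeeping: `J` and `Jᶜ` partition
  have h1 : μ.real (D ∩ T ∩ Jᶜ) + μ.real (D ∩ (T ∩ J)) = μ.real (D ∩ T) := by
    have h := measureReal_inter_add_sdiff (μ := μ) (s := D ∩ T) (hmeas J)
    have hset1 : D ∩ T ∩ J = D ∩ (T ∩ J) := inter_assoc D T J
    have hset2 : (D ∩ T) \ J = D ∩ T ∩ Jᶜ := rfl
    rw [hset1, hset2] at h; linarith
  have h2 : μ.real (D ∩ Jᶜ) + μ.real (D ∩ J) = μ.real D := by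
    have h := measureReal_inter_add_sdiff (μ := μ) (s := D) (hmeas J)
    have hset : D \ J = D ∩ Jᶜ := rfl
    rw [hset] at h; linarith
  have hmono : μ.real (D' ∩ T) ≤ μ.real (D' ∩ T') := measureReal_mono hTT'
  rw [hD'eq] at hmono ⊢
  have hDTJ : D ∩ Jᶜ ∩ T = D ∩ T ∩ Jᶜ := inter_right_comm D Jᶜ T
  rw [hDTJ] at hmono
  have hDn : 0 ≤ μ.real D := measureReal_nonneg
  -- `μ(D ∩ T) μ(D ∩ Jᶜ) ≤ μ(D ∩ T ∩ Jᶜ) μ(D)`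
  have step : μ.real (D ∩ T) * μ.real (D ∩ Jᶜ) ≤ μ.real (D ∩ T ∩ Jᶜ) * μ.real D := by
    have e1 : μ.real (D ∩ Jᶜ) = μ.real D - μ.real (D ∩ J) := by linarith
    have e2 : μ.real (D ∩ T ∩ Jᶜ) = μ.real (D ∩ T) - μ.real (D ∩ (T ∩ J)) := by linarith
    rw [e1, e2]; nlinarith [key]
  calc μ.real (D ∩ T) * μ.real (D ∩ Jᶜ) ≤ μ.real (D ∩ T ∩ Jᶜ) * μ.real D := step
    _ ≤ μ.real (D ∩ Jᶜ ∩ T') * μ.real D := mul_le_mul_of_nonneg_right hmono hDn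

/-- **THEOREM — the chain rule transfers to single-edge extremality at the pair functional `1{s(x,u) ∈ 𝐂_x}`.**  Owner `x`, a vertex
`u ≠ x`, observers `o, v`, avoided set `Y ∌ x, u, v`, weights `w < 1`, `μ = prodBernoulli w`, `μ₀` the law with the pair `s(x,u)` switched
off.  If the single-edge chain rule holds for `(μ₀; x, u, v, o, Y)` (hypothesis `hCR`, verbatim the inequality of `Consts.SingleEdgeChainRule`),
then the level-0 margin of the conditioned slack hierarchy at the single-pair value `p⋆` (the inequality of `Consts.SingleEdgeExtremal`) is
nonnegative at `f = 1{s(x,u) ∈ 𝐂_x}`: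
`covD(f, v) · [μ(D) μ(D₁ ∩ O) − μ(D₁) μ(D ∩ {x ↔ o})] ≤ covD(f, o) · [μ(D₁) μ(D ∩ {x ↮ v})]`, `D = {x ↮ Y}`, `D₁ = D ∩ {v ↮ Y}`,
`O = {x ↔ o} ∪ {v ↔ o}` — whatever the weight of the pair `s(x,u)`. [cite: VandenbergHaggstromKahn2005, Thm. 1.1 (pp. 3–5), Thm. 1.4 (p. 7)] -/
theorem see_pairOpen_of_chainRule (w : Sym2 V → unitInterval) (hw : ∀ d, w d < 1) (x u v o : V) (Y : Set V) (hxu : x ≠ u)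
    (hx : x ∉ Y) (hu : u ∉ Y) (hv : v ∉ Y)
    (hCR :
      (prodBernoulli fun d => if d = s(x, u) then 0 else w d).real
            ({ω : BondConfig V | ∀ y ∈ Y, ¬ (openGraph ω).Reachable x y} ∩ {ω | ¬ (openGraph ω).Reachable x v}) *
          ((prodBernoulli fun d => if d = s(x, u) then 0 else w d).real
                ({ω : BondConfig V | ∀ y ∈ Y, ¬ (openGraph ω).Reachable x y ∧ ¬ (openGraph ω).Reachable u y ∧
                    ¬ (openGraph ω).Reachable v y} ∩ (openConn x o ∪ openConn u o ∪ openConn v o)) *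
              (prodBernoulli fun d => if d = s(x, u) then 0 else w d).real
                {ω : BondConfig V | ∀ y ∈ Y, ¬ (openGraph ω).Reachable x y ∧ ¬ (openGraph ω).Reachable u y} -
            (prodBernoulli fun d => if d = s(x, u) then 0 else w d).real
                ({ω : BondConfig V | ∀ y ∈ Y, ¬ (openGraph ω).Reachable x y ∧ ¬ (openGraph ω).Reachable u y} ∩
                  (openConn x o ∪ openConn u o)) *
              (prodBernoulli fun d => if d = s(x, u) then 0 else w d).real
                {ω : BondConfig V | ∀ y ∈ Y, ¬ (openGraph ω).Reachable x y ∧ ¬ (openGraph ω).Reachable u y ∧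
                  ¬ (openGraph ω).Reachable v y}) ≤
        (prodBernoulli fun d => if d = s(x, u) then 0 else w d).real
            ({ω : BondConfig V | ∀ y ∈ Y, ¬ (openGraph ω).Reachable x y ∧ ¬ (openGraph ω).Reachable u y} ∩
              {ω | ¬ (openGraph ω).Reachable x v ∧ ¬ (openGraph ω).Reachable u v}) *
          ((prodBernoulli fun d => if d = s(x, u) then 0 else w d).real
                ({ω : BondConfig V | ∀ y ∈ Y, ¬ (openGraph ω).Reachable x y ∧ ¬ (openGraph ω).Reachable u y ∧
                    ¬ (openGraph ω).Reachable v y} ∩ (openConn x o ∪ openConn u o ∪ openConn v o)) *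
              (prodBernoulli fun d => if d = s(x, u) then 0 else w d).real
                {ω : BondConfig V | ∀ y ∈ Y, ¬ (openGraph ω).Reachable x y} -
            (prodBernoulli fun d => if d = s(x, u) then 0 else w d).real
                ({ω : BondConfig V | ∀ y ∈ Y, ¬ (openGraph ω).Reachable x y} ∩ openConn x o) *
              (prodBernoulli fun d => if d = s(x, u) then 0 else w d).real
                {ω : BondConfig V | ∀ y ∈ Y, ¬ (openGraph ω).Reachable x y ∧ ¬ (openGraph ω).Reachable u y ∧
                  ¬ (openGraph ω).Reachable v y})) :
    CSH.covD w x Y (fun C => if s(x, u) ∈ C then (1 : ℝ) else 0) v *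
        ((prodBernoulli w).real {ω : BondConfig V | ∀ y ∈ Y, ¬ (openGraph ω).Reachable x y} *
            (prodBernoulli w).real
              ({ω : BondConfig V | ∀ y ∈ Y, ¬ (openGraph ω).Reachable x y ∧ ¬ (openGraph ω).Reachable v y} ∩
                (openConn x o ∪ openConn v o)) -
          (prodBernoulli w).real
              {ω : BondConfig V | ∀ y ∈ Y, ¬ (openGraph ω).Reachable x y ∧ ¬ (openGraph ω).Reachable v y} *
            (prodBernoulli w).real ({ω : BondConfig V | ∀ y ∈ Y, ¬ (openGraph ω).Reachable x y} ∩ openConn x o)) ≤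
      CSH.covD w x Y (fun C => if s(x, u) ∈ C then (1 : ℝ) else 0) o *
        ((prodBernoulli w).real
            {ω : BondConfig V | ∀ y ∈ Y, ¬ (openGraph ω).Reachable x y ∧ ¬ (openGraph ω).Reachable v y} *
          (prodBernoulli w).real
            ({ω : BondConfig V | ∀ y ∈ Y, ¬ (openGraph ω).Reachable x y} ∩ {ω | ¬ (openGraph ω).Reachable x v})) := by
  classical
  set e : Sym2 V := s(x, u) with he_def
  set μ := prodBernoulli w with hμ
  set w₀ : Sym2 V → unitInterval := fun d => if d = e then 0 else w d with hw₀
  set μ₀ := prodBernoulli w₀ with hμ₀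
  have hmeas : ∀ T : Set (BondConfig V), MeasurableSet T := fun _ => MeasurableSet.of_discrete
  -- events (the same sets under `μ` and `μ₀`)
  set R1 : Set (BondConfig V) := {ω | ∀ y ∈ Y, ¬ (openGraph ω).Reachable x y} with hR1
  set R2 : Set (BondConfig V) := {ω | ∀ y ∈ Y, ¬ (openGraph ω).Reachable x y ∧ ¬ (openGraph ω).Reachable u y} with hR2
  set R3 : Set (BondConfig V) :=
    {ω | ∀ y ∈ Y, ¬ (openGraph ω).Reachable x y ∧ ¬ (openGraph ω).Reachable u y ∧ ¬ (openGraph ω).Reachable v y} with hR3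
  set Rxv : Set (BondConfig V) := {ω | ∀ y ∈ Y, ¬ (openGraph ω).Reachable x y ∧ ¬ (openGraph ω).Reachable v y} with hRxv
  set Oo : Set (BondConfig V) := openConn x o ∪ openConn u o ∪ openConn v o with hOo
  set Oxu : Set (BondConfig V) := openConn x o ∪ openConn u o with hOxu
  set Oxv : Set (BondConfig V) := openConn x o ∪ openConn v o with hOxv
  set Nx : Set (BondConfig V) := {ω | ¬ (openGraph ω).Reachable x v} with hNx
  set Nxu : Set (BondConfig V) := {ω | ¬ (openGraph ω).Reachable x v ∧ ¬ (openGraph ω).Reachable u v} with hNxu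
  -- the μ₀-numbers
  set d1 : ℝ := μ₀.real R1 with hd1
  set d2 : ℝ := μ₀.real R2 with hd2
  set d3 : ℝ := μ₀.real R3 with hd3
  set dxv : ℝ := μ₀.real Rxv with hdxv
  set a1 : ℝ := μ₀.real (R1 ∩ openConn x o) with ha1
  set a2 : ℝ := μ₀.real (R2 ∩ Oxu) with ha2
  set a3 : ℝ := μ₀.real (R3 ∩ Oo) with ha3
  set axv : ℝ := μ₀.real (Rxv ∩ Oxv) with haxv
  set n1 : ℝ := μ₀.real (R1 ∩ Nx) with hn1
  set n2 : ℝ := μ₀.real (R2 ∩ Nxu) with hn2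
  set q : ℝ := (w e : ℝ) with hq
  -- (0) the chain rule, named
  have hCR' : n1 * (a3 * d2 - a2 * d3) ≤ n2 * (a3 * d1 - a1 * d3) := hCR
  -- (1) the covariances in closed form
  have hco : CSH.covD w x Y (fun C => if s(x, u) ∈ C then (1 : ℝ) else 0) o = q * (1 - q) * (d1 * a2 - d2 * a1) := by
    rw [covD_pairOpen_eq w x u o Y hxu]
  have hB1 : μ₀.real (R1 ∩ openConn x v) = d1 - n1 := by
    have h := measureReal_inter_add_sdiff (μ := μ₀) (s := R1) (hmeas (openConn x v))
    have hset : R1 \ openConn x v = R1 ∩ Nx := rfl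
    rw [hset] at h; linarith
  have hB2 : μ₀.real (R2 ∩ (openConn x v ∪ openConn u v)) = d2 - n2 := by
    have h := measureReal_inter_add_sdiff (μ := μ₀) (s := R2) (hmeas (openConn x v ∪ openConn u v))
    have hset : R2 \ (openConn x v ∪ openConn u v) = R2 ∩ Nxu := by
      ext ω; simp only [hNxu, mem_sdiff, mem_inter_iff, mem_union, mem_setOf_eq, openConn, not_or]
    rw [hset] at h; linarith
  have hcv : CSH.covD w x Y (fun C => if s(x, u) ∈ C then (1 : ℝ) else 0) v = q * (1 - q) * (d2 * n1 - d1 * n2) := by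
    rw [covD_pairOpen_eq w x u v Y hxu]
    change q * (1 - q) * (d1 * μ₀.real (R2 ∩ (openConn x v ∪ openConn u v)) - d2 * μ₀.real (R1 ∩ openConn x v)) = _
    rw [hB1, hB2]; ring
  -- (2) pinning `e` in the four `μ`-quantities of the margin
  have pinR1 : μ.real R1 = q * d2 + (1 - q) * d1 := by
    refine real_split_pair w e R1 R2 (fun ω heω => ?_)
    simp only [hR1, hR2, mem_setOf_eq]
    exact avoid_iff_sdiff_pair Y heω
  have pinA1 : μ.real (R1 ∩ openConn x o) = q * a2 + (1 - q) * a1 := by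
    refine real_split_pair w e (R1 ∩ openConn x o) (R2 ∩ Oxu) (fun ω heω => ?_)
    simp only [hR1, hR2, hOxu, mem_inter_iff, mem_setOf_eq, mem_union, openConn]
    rw [avoid_iff_sdiff_pair Y heω, CSH.reachable_iff_sdiff_pair o heω]
  have pinN1 : μ.real (R1 ∩ Nx) = q * n2 + (1 - q) * n1 := by
    refine real_split_pair w e (R1 ∩ Nx) (R2 ∩ Nxu) (fun ω heω => ?_)
    simp only [hR1, hR2, hNx, hNxu, mem_inter_iff, mem_setOf_eq]
    rw [avoid_iff_sdiff_pair Y heω, CSH.reachable_iff_sdiff_pair v heω, not_or]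
  -- reachability from the third vertex `v` with `e` open
  have hins : ∀ ω : BondConfig V, e ∈ ω → insert s(x, u) (ω \ {e}) = ω := fun ω heω => by
    rw [he_def, Set.insert_sdiff_singleton, Set.insert_eq_of_mem heω]
  have reach_v : ∀ ω : BondConfig V, e ∈ ω → ∀ t : V,
      (openGraph ω).Reachable v t ↔
        (openGraph (ω \ {e})).Reachable v t ∨
          ((openGraph (ω \ {e})).Reachable v x ∧ (openGraph (ω \ {e})).Reachable u t) ∨
          ((openGraph (ω \ {e})).Reachable v u ∧ (openGraph (ω \ {e})).Reachable x t) := by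
    intro ω heω t
    have key := KNSep.reachable_insert_iff (ω \ {e}) x u v t
    rwa [hins ω heω] at key
  have pinRxv : μ.real Rxv = q * d3 + (1 - q) * dxv := by
    refine real_split_pair w e Rxv R3 (fun ω heω => ?_)
    simp only [hRxv, hR3, mem_setOf_eq]
    have hav := avoid_iff_sdiff_pair (x := x) (v := u) Y heω
    constructor
    · intro h y hy
      have hxu' := (hav.1 (fun y' hy' => (h y' hy').1)) y hy
      refine ⟨hxu'.1, hxu'.2, fun hvy => (h y hy).2 ?_⟩
      exact (reach_v ω heω y).2 (Or.inl hvy)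
    · intro h y hy
      refine ⟨(hav.2 (fun y' hy' => ⟨(h y' hy').1, (h y' hy').2.1⟩)) y hy, fun hvy => ?_⟩
      rcases (reach_v ω heω y).1 hvy with h1 | ⟨-, h2⟩ | ⟨-, h3⟩
      · exact (h y hy).2.2 h1
      · exact (h y hy).2.1 h2
      · exact (h y hy).1 h3
  have pinAxv : μ.real (Rxv ∩ Oxv) = q * a3 + (1 - q) * axv := by
    refine real_split_pair w e (Rxv ∩ Oxv) (R3 ∩ Oo) (fun ω heω => ?_)
    have hav := avoid_iff_sdiff_pair (x := x) (v := u) Y heω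
    simp only [hRxv, hR3, hOxv, hOo, mem_inter_iff, mem_setOf_eq, mem_union, openConn]
    constructor
    · rintro ⟨h, hO⟩
      refine ⟨fun y hy => ?_, ?_⟩
      · have hxu' := (hav.1 (fun y' hy' => (h y' hy').1)) y hy
        exact ⟨hxu'.1, hxu'.2, fun hvy => (h y hy).2 ((reach_v ω heω y).2 (Or.inl hvy))⟩
      · rcases hO with hxo | hvo
        · rcases (CSH.reachable_iff_sdiff_pair o heω).1 hxo with h1 | h2
          · exact Or.inl (Or.inl h1)
          · exact Or.inl (Or.inr h2)
        · rcases (reach_v ω heω o).1 hvo with h1 | ⟨-, h2⟩ | ⟨-, h3⟩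
          · exact Or.inr h1
          · exact Or.inl (Or.inr h2)
          · exact Or.inl (Or.inl h3)
    · rintro ⟨h, hO⟩
      refine ⟨fun y hy => ⟨(hav.2 (fun y' hy' => ⟨(h y' hy').1, (h y' hy').2.1⟩)) y hy, fun hvy => ?_⟩, ?_⟩
      · rcases (reach_v ω heω y).1 hvy with h1 | ⟨-, h2⟩ | ⟨-, h3⟩
        · exact (h y hy).2.2 h1
        · exact (h y hy).2.1 h2
        · exact (h y hy).1 h3
      · rcases hO with (hxo | huo) | hvo
        · exact Or.inl ((CSH.reachable_iff_sdiff_pair o heω).2 (Or.inl hxo))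
        · exact Or.inl ((CSH.reachable_iff_sdiff_pair o heω).2 (Or.inr huo))
        · exact Or.inr ((reach_v ω heω o).2 (Or.inl hvo))
  -- (3) source monotonicity: `n1 d2 ≥ n2 d1` and `axv d3 ≤ a3 dxv`
  have mono1 : (d1 - n1) * d2 ≤ (d2 - n2) * d1 := by
    have h := real_reach_avoid_insert_ge w₀ {x} Y u v
    have e1 : {ω : BondConfig V | ∀ s ∈ ({x} : Set V), ∀ y ∈ Y, ¬ (openGraph ω).Reachable s y} = R1 := by
      ext ω; simp only [mem_setOf_eq, mem_singleton_iff, forall_eq, hR1]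
    have e2 : {ω : BondConfig V | ∀ s ∈ insert u ({x} : Set V), ∀ y ∈ Y, ¬ (openGraph ω).Reachable s y} = R2 := by
      ext ω; simp only [mem_setOf_eq, mem_insert_iff, mem_singleton_iff, forall_eq_or_imp, forall_eq, hR2]
      exact ⟨fun h y hy => ⟨h.2 y hy, h.1 y hy⟩, fun h => ⟨fun y hy => (h y hy).2, fun y hy => (h y hy).1⟩⟩
    have e3 : {ω : BondConfig V | ∃ s ∈ ({x} : Set V), (openGraph ω).Reachable s v} = openConn x v := by
      ext ω; simp only [mem_setOf_eq, mem_singleton_iff, exists_eq_left, openConn]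
    have e4 : {ω : BondConfig V | ∃ s ∈ insert u ({x} : Set V), (openGraph ω).Reachable s v} = openConn x v ∪ openConn u v := by
      ext ω; simp only [mem_setOf_eq, mem_insert_iff, mem_singleton_iff, exists_eq_or_imp, exists_eq_left, mem_union, openConn]
      exact Or.comm
    rw [e1, e2, e3, e4, hB1, hB2] at h
    exact h
  have mono2 : axv * d3 ≤ a3 * dxv := by
    have h := real_reach_avoid_insert_ge w₀ {x, v} Y u o
    have e1 : {ω : BondConfig V | ∀ s ∈ ({x, v} : Set V), ∀ y ∈ Y, ¬ (openGraph ω).Reachable s y} = Rxv := by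
      ext ω; simp only [mem_setOf_eq, mem_insert_iff, mem_singleton_iff, forall_eq_or_imp, forall_eq, hRxv]
      exact ⟨fun h y hy => ⟨h.1 y hy, h.2 y hy⟩, fun h => ⟨fun y hy => (h y hy).1, fun y hy => (h y hy).2⟩⟩
    have e2 : {ω : BondConfig V | ∀ s ∈ insert u ({x, v} : Set V), ∀ y ∈ Y, ¬ (openGraph ω).Reachable s y} = R3 := by
      ext ω; simp only [mem_setOf_eq, mem_insert_iff, mem_singleton_iff, forall_eq_or_imp, forall_eq, hR3]
      exact ⟨fun h y hy => ⟨h.2.1 y hy, h.1 y hy, h.2.2 y hy⟩,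
        fun h => ⟨fun y hy => (h y hy).2.1, fun y hy => (h y hy).1, fun y hy => (h y hy).2.2⟩⟩
    have e3 : {ω : BondConfig V | ∃ s ∈ ({x, v} : Set V), (openGraph ω).Reachable s o} = Oxv := by
      ext ω; simp only [mem_setOf_eq, mem_insert_iff, mem_singleton_iff, exists_eq_or_imp, exists_eq_left, hOxv, mem_union, openConn]
    have e4 : {ω : BondConfig V | ∃ s ∈ insert u ({x, v} : Set V), (openGraph ω).Reachable s o} = Oo := by
      ext ω
      simp only [mem_setOf_eq, mem_insert_iff, mem_singleton_iff, exists_eq_or_imp, exists_eq_left, hOo, hOxu, mem_union,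
        openConn]
      tauto
    rw [e1, e2, e3, e4] at h
    -- h : μ₀.real (Rxv ∩ Oxv) * μ₀.real R3 ≤ μ₀.real (R3 ∩ Oo) * μ₀.real Rxv
    exact h
  -- (4) `d3 > 0`: the empty configuration avoids everything
  have hlt0 : ∀ d, w₀ d < 1 := fun d => by
    simp only [hw₀]; split_ifs
    · exact zero_lt_one
    · exact hw d
  have hbot : openGraph (∅ : BondConfig V) = ⊥ := by unfold openGraph; exact SimpleGraph.fromEdgeSet_empty
  have hnoreach : ∀ a b : V, a ≠ b → ¬ (openGraph (∅ : BondConfig V)).Reachable a b := fun a b hab h => by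
    rw [hbot, SimpleGraph.reachable_bot] at h; exact hab h
  have hd3 : 0 < d3 :=
    CSH.prodBernoulli_real_pos_of_empty_mem w₀ hlt0 (fun y hy =>
      ⟨hnoreach x y (fun h => hx (h ▸ hy)), hnoreach u y (fun h => hu (h ▸ hy)), hnoreach v y (fun h => hv (h ▸ hy))⟩)
  -- (5) assemble
  rw [hco, hcv, pinR1, pinA1, pinN1, pinRxv, pinAxv]
  have hq0 : 0 ≤ q := (w e).2.1
  have hq1 : q ≤ 1 := (w e).2.2
  have hd1n : 0 ≤ d1 := measureReal_nonneg
  have hd2n : 0 ≤ d2 := measureReal_nonneg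
  have hdxv : 0 ≤ dxv := measureReal_nonneg
  clear_value q d1 d2 d3 dxv a1 a2 a3 axv n1 n2
  have hdn : 0 ≤ q * d2 + (1 - q) * d1 := add_nonneg (mul_nonneg hq0 hd2n) (mul_nonneg (sub_nonneg.mpr hq1) hd1n)
  -- the chain-rule part
  have term1 : 0 ≤ (n1 * a2 - n2 * a1) * d3 - (n1 * d2 - n2 * d1) * a3 := by
    have h : (n1 * a2 - n2 * a1) * d3 - (n1 * d2 - n2 * d1) * a3 = n2 * (a3 * d1 - a1 * d3) - n1 * (a3 * d2 - a2 * d3) := by ring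
    rw [h]; exact sub_nonneg.mpr hCR'
  -- the source-monotonicity part
  have hN : 0 ≤ n1 * d2 - n2 * d1 := by
    have h : n1 * d2 - n2 * d1 = (d2 - n2) * d1 - (d1 - n1) * d2 := by ring
    rw [h]; exact sub_nonneg.mpr mono1
  have term2 : 0 ≤ (n1 * a2 - n2 * a1) * dxv - (n1 * d2 - n2 * d1) * axv := by
    have hT : ((n1 * a2 - n2 * a1) * dxv - (n1 * d2 - n2 * d1) * axv) * d3 =
        ((n1 * a2 - n2 * a1) * d3 - (n1 * d2 - n2 * d1) * a3) * dxv + (n1 * d2 - n2 * d1) * (a3 * dxv - axv * d3) := by ring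
    have h3 : 0 * d3 ≤ ((n1 * a2 - n2 * a1) * dxv - (n1 * d2 - n2 * d1) * axv) * d3 := by
      rw [zero_mul, hT]
      exact add_nonneg (mul_nonneg term1 hdxv) (mul_nonneg hN (sub_nonneg.mpr mono2))
    exact le_of_mul_le_mul_right h3 hd3
  have hid : q * (1 - q) * (d1 * a2 - d2 * a1) * ((q * d3 + (1 - q) * dxv) * (q * n2 + (1 - q) * n1)) -
      q * (1 - q) * (d2 * n1 - d1 * n2) *
        ((q * d2 + (1 - q) * d1) * (q * a3 + (1 - q) * axv) - (q * d3 + (1 - q) * dxv) * (q * a2 + (1 - q) * a1)) =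
      q * (1 - q) * (q * d2 + (1 - q) * d1) *
        (q * ((n1 * a2 - n2 * a1) * d3 - (n1 * d2 - n2 * d1) * a3) +
          (1 - q) * ((n1 * a2 - n2 * a1) * dxv - (n1 * d2 - n2 * d1) * axv)) := by ring
  have hpos : 0 ≤ q * (1 - q) * (q * d2 + (1 - q) * d1) *
      (q * ((n1 * a2 - n2 * a1) * d3 - (n1 * d2 - n2 * d1) * a3) +
        (1 - q) * ((n1 * a2 - n2 * a1) * dxv - (n1 * d2 - n2 * d1) * axv)) := by
    have hq' : 0 ≤ q * (1 - q) := mul_nonneg hq0 (sub_nonneg.mpr hq1)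
    have hin : 0 ≤ q * ((n1 * a2 - n2 * a1) * d3 - (n1 * d2 - n2 * d1) * a3) +
        (1 - q) * ((n1 * a2 - n2 * a1) * dxv - (n1 * d2 - n2 * d1) * axv) :=
      add_nonneg (mul_nonneg hq0 term1) (mul_nonneg (sub_nonneg.mpr hq1) term2)
    exact mul_nonneg (mul_nonneg hq' hdn) hin
  rw [← sub_nonneg, hid]
  exact hpos

end Consts

end Summit.CriticalPhenomena.PercolationContinuityZ3.Theorems

end
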